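import Summits.BirchSwinnertonDyer.BirchSwinnertonDyer.Theorems.EisensteinPrimesLinePsiAtMultiplicativePrime
import Summits.BirchSwinnertonDyer.BirchSwinnertonDyer.Theorems.CumulativeHeegnerLeopoldtCumulativeHeegnerInclusionAtThreeStubResidualSelmerFiniteLineDeterminant
import Literature.NumberTheory.GaloisRepresentations.TateLevelOneWildOdd
import Literature.NumberTheory.EllipticCurves.DeligneSerreWeightOneIrreducibleKroneckerWeberProofs
import HarnessLib

/-!
# Crux 3 `MazurMCOnCellB` (stmt-BirchSwinnertonDyer-19033), line `twistback` v4 — brick (F3″):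
# the WEIL RELATION `φ·ψ = ω` for the Dirichlet presentations of a rational `p`-line and the
# CONDUCTOR SUPPORT of primitive presentations — the door's binder `hφψ` is a THEOREM

Width seat bsd-line-x2-p1-w7 (g0), self-assigned sequel to bricks (F3)/(F3′). HONEST FRAMING (cell
`bsd-eis`, run/shared/lean/pub/bsd-eis/): TOOL THEOREMS ONLY (no `def`, no named fact, no `sorry`);
every input a tree THEOREM; nothing booked; no main conjecture / BSD proved for any curve; no summit
statement is proved; 0 cells / labels / tiers move.

WHY. The KL-flat door (`…TwistbackKLFlatPartnerUnits` §1–§3, p645771; `…KLFlatPartnerUnitsPsi`,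
p650639) carries per pair the binder
`hφψ : ∀ a : ℕ, ¬ p ∣ a → φ (a : ZMod m) * (a : ZMod p)⁻¹ = ψ⁻¹ (a : ZMod d)` — Greenberg–Vatsal's
"`φψ = ω`" (p. 28) for the PRIMITIVE Dirichlet presentations `φ` mod `m` (on the line `Φ₀`) and `ψ`
mod `d` (on `E[p]/Φ₀`), cited, not derived. It IS derivable from the binders already present
(`hΦ`, `hφ0`, `hψ0`, `hφ.IsPrimitive`, `hψ.IsPrimitive`):

* §1 **`apply_mul_apply_eq_modNCyclotomicCharacter`** — Galois level: `φ(χ_m σ)·ψ(χ_d σ) = χ_p(σ)`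
  for EVERY `σ ∈ Γ_ℚ`, from `det ρ̄_{E,p} = χ_p` (Weil pairing, tree `det_eq_modNCyclotomicCharacter`)
  through the chl cell's "determinant on a stable line"
  `CumulativeHeegnerInclusionAtThreeStubB1LineDeterminant.smul_sub_nsmul_mem_of_smul_sub_eq` and the
  scalar comparison `natCast_eq_intCast_of_smul_sub_mem` of brick (F3);
* §2 `apply_natCast_mul_apply_natCast` — `φ(a)ψ(a) = a (mod p)` for `a` prime to `p m d`
  (surjectivity of `χ_{pmd}` on `Γ_ℚ`: the tree's `modNCyclotomicCharacter_rat_surjective`; compatibility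
  `unitsMap_modNCyclotomicCharacter_of_dvd`);
* §3 **`level_dvd_mul_of_isPrimitive`** — if `α` mod `n₁` is PRIMITIVE and `α(χ_{n₁}σ)β(χ_{n₂}σ) = χ_p(σ)`
  on `Γ_ℚ` then `n₁ ∣ p n₂` (the lifts of `α` and of `θ_p·β⁻¹` to level `n₁ p n₂` agree on the image
  of `Γ_ℚ` = everything, so have equal conductors: Mathlib `conductor_changeLevel`,
  `conductor_dvd_level`); hence **`dvd_iff_dvd_of_isPrimitive`**: a prime `ℓ ≠ p` divides `m` iff it
  divides `d` — `φ` and `ψ = ωφ⁻¹` ramify at the same primes away from `p`;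
* §4 **`apply_natCast_mul_inv_eq_inv_apply`** — VERBATIM `hφψ`, for every `a` with `p ∤ a`
  (at `a` sharing a prime with `m d` both sides vanish by §3).

References: [GreenbergVatsal2000] §2 p. 28, §3 pp. 41–42; [SilvermanCSS1997] Ch. II §7–§8
(det ρ̄_{E,m} = χ_m); [SilvermanAEC2009] III.8; [Washington1997] Ch. 3 (conductors of Dirichlet
characters), Lemma 2.12 ff.
-/

set_option autoImplicit false
set_option linter.dupNamespace false

noncomputable section

open scoped Classical

open NumberField IsDedekindDomain Field WeierstrassCurve
  Literature.NumberTheory.EllipticCurves Literature.NumberTheory.GaloisRepresentations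
  Literature.NumberTheory.EllipticCurves.Rank1Residual
  Summit.BirchSwinnertonDyer.Rank1Residual.X2.ResidualDevissageModules
  Summit.BirchSwinnertonDyer.BirchSwinnertonDyer.Theorems.EisensteinPrimesLinePsiAtMultiplicativePrime
  Summit.BirchSwinnertonDyer.BirchSwinnertonDyer.Theorems.CumulativeHeegnerInclusionAtThreeStubB1LineDeterminant

namespace Summit.BirchSwinnertonDyer.BirchSwinnertonDyer.Theorems.EisensteinPrimesLineCharactersWeilRelation

variable {W : WeierstrassCurve ℚ} [W.IsElliptic] {p : ℕ} [hp : Fact p.Prime]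

/-! ## §1. Galois level: `φ(χ_m σ) · ψ(χ_d σ) = χ_p(σ)` for every `σ ∈ Γ_ℚ` -/

/-- **Weil relation at the Galois level.** For a rational line `Φ₀ ≤ E[p]` on which `Γ_ℚ` acts
through the Dirichlet character `φ` mod `m` (`hφ0` shape) and on whose quotient it acts through
`ψ` mod `d` (`hψ0` shape): for every `σ ∈ Γ_ℚ`, `φ(χ_m σ)·ψ(χ_d σ) = χ_p(σ)` in `𝔽_p` — because
`det ρ̄_{E,p} = χ_p` (Weil pairing; the tree's `det_eq_modNCyclotomicCharacter`, through the chl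
cell's "determinant on a stable line" `smul_sub_nsmul_mem_of_smul_sub_eq`). Greenberg–Vatsal p. 28:
"`φψ = ω` where `ω` denotes the Teichmüller character". [cite: GreenbergVatsal2000, §2 p. 28 (φψ = ω)]
[cite: SilvermanCSS1997, Ch. II §7 Proposition and §8 (det ρ̄_{E,m} = χ_m)] -/
theorem apply_mul_apply_eq_modNCyclotomicCharacter {Φ₀ : AddSubgroup (geomTorsion W (p : ℤ))}
    (hΦ : IsRationalLine W p Φ₀)
    {m : ℕ} [NeZero m] (φ : DirichletCharacter (ZMod p) m)
    {d : ℕ} [NeZero d] (ψ : DirichletCharacter (ZMod p) d)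
    (hφ0 : ∀ (σ : absoluteGaloisGroup ℚ), ∀ P ∈ Φ₀,
      σ • P = (φ ((modNCyclotomicCharacter ℚ m σ : (ZMod m)ˣ) : ZMod m)).val • P)
    (hψ0 : ∀ (σ : absoluteGaloisGroup ℚ) (Q : geomTorsion W (p : ℤ)),
      σ • Q - (ψ ((modNCyclotomicCharacter ℚ d σ : (ZMod d)ˣ) : ZMod d)).val • Q ∈ Φ₀)
    (σ : absoluteGaloisGroup ℚ) :
    φ ((modNCyclotomicCharacter ℚ m σ : (ZMod m)ˣ) : ZMod m) *
        ψ ((modNCyclotomicCharacter ℚ d σ : (ZMod d)ˣ) : ZMod d) =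
      ((modNCyclotomicCharacter ℚ p σ : (ZMod p)ˣ) : ZMod p) := by
  -- the line as a stable subgroup
  let S : StableSubgroup (absoluteGaloisGroup ℚ) (geomTorsion W (p : ℤ)) :=
    ⟨Φ₀, fun g _ hm ↦ hΦ.2 g _ hm⟩
  have hS : Nat.card S.Sub = p := hΦ.1
  -- `φ(χ_m σ)` is a unit `u`
  set uu : (ZMod p)ˣ := φ.toUnitHom (modNCyclotomicCharacter ℚ m σ) with huu
  have hu : (uu : ZMod p) = φ ((modNCyclotomicCharacter ℚ m σ : (ZMod m)ˣ) : ZMod m) := by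
    rw [huu, MulChar.coe_toUnitHom]
  set c : ZMod p := ((modNCyclotomicCharacter ℚ p σ : (ZMod p)ˣ) : ZMod p) with hc
  set k : ℕ := (uu : ZMod p).val with hk
  set k' : ℕ := ((uu⁻¹ : (ZMod p)ˣ) * c : ZMod p).val with hk'
  have hkk' : (k : ZMod p) * (k' : ZMod p) = c := by
    rw [hk, hk', ZMod.natCast_zmod_val, ZMod.natCast_zmod_val, ← mul_assoc, Units.mul_inv, one_mul]
  have hkS : ∀ x : S.Sub, σ • x = k • x := by
    intro x
    apply S.incl_injective
    rw [S.incl_smul, map_nsmul]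
    have hx : S.incl x ∈ Φ₀ := x.2
    rw [hφ0 σ _ hx, ← hu]
  -- `σ` acts on `E[p]/Φ₀` as `k'` (determinant) and as `ψ(χ_d σ)` (hψ0)
  have h1 : ∀ P : geomTorsion W (p : ℤ), σ • P - (k' : ℤ) • P ∈ Φ₀ := fun P ↦ by
    rw [natCast_zsmul]
    exact smul_sub_nsmul_mem_of_smul_sub_eq W p S hS σ k k' hkk' hkS P
  have h2 := natCast_eq_intCast_of_smul_sub_mem hΦ.1 h1 (hψ0 σ)
  rw [ZMod.natCast_zmod_val, Int.cast_natCast, hk', ZMod.natCast_zmod_val] at h2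
  rw [h2, ← hu, ← mul_assoc, Units.mul_inv, one_mul]

/-! ## §2. Dirichlet level at arguments prime to `p·m·d` -/

/-- **Weil relation at integers prime to `p·m·d`**: `φ(a)·ψ(a) = a (mod p)` — the Galois-level
identity read at a `σ` with `χ_{pmd}(σ) = a`. [cite: GreenbergVatsal2000, §2 p. 28 (φψ = ω)] -/
theorem apply_natCast_mul_apply_natCast {Φ₀ : AddSubgroup (geomTorsion W (p : ℤ))}
    (hΦ : IsRationalLine W p Φ₀)
    {m : ℕ} [NeZero m] (φ : DirichletCharacter (ZMod p) m)
    {d : ℕ} [NeZero d] (ψ : DirichletCharacter (ZMod p) d)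
    (hφ0 : ∀ (σ : absoluteGaloisGroup ℚ), ∀ P ∈ Φ₀,
      σ • P = (φ ((modNCyclotomicCharacter ℚ m σ : (ZMod m)ˣ) : ZMod m)).val • P)
    (hψ0 : ∀ (σ : absoluteGaloisGroup ℚ) (Q : geomTorsion W (p : ℤ)),
      σ • Q - (ψ ((modNCyclotomicCharacter ℚ d σ : (ZMod d)ˣ) : ZMod d)).val • Q ∈ Φ₀)
    {a : ℕ} (ha : a.Coprime (p * m * d)) :
    φ (a : ZMod m) * ψ (a : ZMod d) = (a : ZMod p) := by
  haveI : NeZero (p * m * d) := ⟨by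
    have := hp.out.ne_zero; have := NeZero.ne m; have := NeZero.ne d; positivity⟩
  set ua : (ZMod (p * m * d))ˣ := ZMod.unitOfCoprime a ha with hua
  obtain ⟨σ, hσ⟩ := modNCyclotomicCharacter_rat_surjective (p * m * d) ua
  have hmL : m ∣ p * m * d := ⟨p * d, by ring⟩
  have hdL : d ∣ p * m * d := ⟨p * m, by ring⟩
  have hpL : p ∣ p * m * d := ⟨m * d, by ring⟩
  have hm : ((modNCyclotomicCharacter ℚ m σ : (ZMod m)ˣ) : ZMod m) = (a : ZMod m) := by
    rw [← unitsMap_modNCyclotomicCharacter_of_dvd ℚ hmL σ, hσ, ZMod.unitsMap_val, hua,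
      ZMod.coe_unitOfCoprime, ZMod.cast_natCast hmL]
  have hd : ((modNCyclotomicCharacter ℚ d σ : (ZMod d)ˣ) : ZMod d) = (a : ZMod d) := by
    rw [← unitsMap_modNCyclotomicCharacter_of_dvd ℚ hdL σ, hσ, ZMod.unitsMap_val, hua,
      ZMod.coe_unitOfCoprime, ZMod.cast_natCast hdL]
  have hpp : ((modNCyclotomicCharacter ℚ p σ : (ZMod p)ˣ) : ZMod p) = (a : ZMod p) := by
    rw [← unitsMap_modNCyclotomicCharacter_of_dvd ℚ hpL σ, hσ, ZMod.unitsMap_val, hua,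
      ZMod.coe_unitOfCoprime, ZMod.cast_natCast hpL]
  have h := apply_mul_apply_eq_modNCyclotomicCharacter hΦ φ ψ hφ0 hψ0 σ
  rwa [hm, hd, hpp] at h


/-! ## §3. Conductor support of PRIMITIVE presentations: `m ∣ p·d` and `d ∣ p·m` -/

omit hp in
/-- Evaluating a lifted Dirichlet character on the cyclotomic character of the bigger level:
`(changeLevel h χ)(χ_{N'} σ) = χ(χ_N σ)` (`χ_{N'} ≡ χ_N (mod N)`). [folklore] -/
theorem changeLevel_apply_modNCyclotomicCharacter {R : Type*} [CommMonoidWithZero R] {N N' : ℕ}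
    [NeZero N] [NeZero N'] (h : N ∣ N') (χ : DirichletCharacter R N) (σ : absoluteGaloisGroup ℚ) :
    DirichletCharacter.changeLevel h χ ((modNCyclotomicCharacter ℚ N' σ : (ZMod N')ˣ) : ZMod N') =
      χ ((modNCyclotomicCharacter ℚ N σ : (ZMod N)ˣ) : ZMod N) := by
  rw [DirichletCharacter.changeLevel_def, MulChar.ofUnitHom_coe, MonoidHom.comp_apply,
    unitsMap_modNCyclotomicCharacter_of_dvd ℚ h σ, MulChar.coe_toUnitHom]

/-- **A primitive character presenting (a piece of) `E[p]` against another character has level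
dividing `p` times the other level.** If `α` mod `n₁` is PRIMITIVE and `α(χ_{n₁} σ)·β(χ_{n₂} σ) = χ_p(σ)`
for every `σ ∈ Γ_ℚ` (`β` mod `n₂`, values in `𝔽_p`), then `n₁ ∣ p·n₂`: on `Γ_ℚ` the character `α`
agrees with the Dirichlet character `θ_p·β⁻¹` mod `p n₂` (`θ_p` the tautological character mod `p`),
the cyclotomic character mod `n₁ p n₂` is onto, so the two lifts coincide and have the same
conductor — `n₁` for the primitive `α`, a divisor of `p n₂` for the other
(`DirichletCharacter.conductor_changeLevel`, `conductor_dvd_level`). [folklore] -/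
theorem level_dvd_mul_of_isPrimitive {n₁ n₂ : ℕ} [NeZero n₁] [NeZero n₂]
    (α : DirichletCharacter (ZMod p) n₁) (β : DirichletCharacter (ZMod p) n₂) (hα : α.IsPrimitive)
    (h : ∀ σ : absoluteGaloisGroup ℚ,
      α ((modNCyclotomicCharacter ℚ n₁ σ : (ZMod n₁)ˣ) : ZMod n₁) *
          β ((modNCyclotomicCharacter ℚ n₂ σ : (ZMod n₂)ˣ) : ZMod n₂) =
        ((modNCyclotomicCharacter ℚ p σ : (ZMod p)ˣ) : ZMod p)) :
    n₁ ∣ p * n₂ := by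
  have hpp := hp.out
  haveI : NeZero (p * n₂) := ⟨mul_ne_zero hpp.ne_zero (NeZero.ne n₂)⟩
  haveI : NeZero (n₁ * (p * n₂)) := ⟨mul_ne_zero (NeZero.ne n₁) (NeZero.ne (p * n₂))⟩
  -- the comparison character `G = θ_p · β⁻¹` mod `p n₂` and the two lifts to level `n₁ p n₂`
  set θ : DirichletCharacter (ZMod p) p := MulChar.ofUnitHom (MonoidHom.id (ZMod p)ˣ) with hθ
  set G : DirichletCharacter (ZMod p) (p * n₂) :=
    DirichletCharacter.changeLevel (dvd_mul_right p n₂) θ *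
      DirichletCharacter.changeLevel (dvd_mul_left n₂ p) β⁻¹ with hG
  set A := DirichletCharacter.changeLevel (dvd_mul_right n₁ (p * n₂)) α with hA
  set B := DirichletCharacter.changeLevel (dvd_mul_left (p * n₂) n₁) G with hB
  have hAB : A = B := by
    refine MulChar.ext fun x ↦ ?_
    obtain ⟨σ, hσ⟩ := modNCyclotomicCharacter_rat_surjective (n₁ * (p * n₂)) x
    rw [← hσ, hA, hB, changeLevel_apply_modNCyclotomicCharacter,
      changeLevel_apply_modNCyclotomicCharacter, hG, MulChar.mul_apply,
      changeLevel_apply_modNCyclotomicCharacter, changeLevel_apply_modNCyclotomicCharacter, hθ,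
      MulChar.ofUnitHom_coe, MonoidHom.id_apply, MulChar.inv_apply_eq_inv']
    -- `β(χ_{n₂} σ)` is a unit, so `α = χ_p · β⁻¹` from `α β = χ_p`
    have hβ : β ((modNCyclotomicCharacter ℚ n₂ σ : (ZMod n₂)ˣ) : ZMod n₂) ≠ 0 := by
      rw [← MulChar.coe_toUnitHom]; exact Units.ne_zero _
    rw [eq_mul_inv_iff_mul_eq₀ hβ]
    exact h σ
  -- conductors
  have hcA : A.conductor = n₁ := by
    rw [hA, DirichletCharacter.conductor_changeLevel]; exact hα
  have hcB : B.conductor ∣ p * n₂ := by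
    rw [hB, DirichletCharacter.conductor_changeLevel]; exact DirichletCharacter.conductor_dvd_level G
  rw [← hcA, hAB]
  exact hcB

/-- **Conductor support.** For a rational line with PRIMITIVE presentations `φ` mod `m`, `ψ` mod
`d`: `m ∣ p·d` and `d ∣ p·m`; hence a prime `ℓ ≠ p` divides `m` iff it divides `d` (the characters
`φ` and `ψ = ωφ⁻¹` have the same ramification away from `p`). [cite: GreenbergVatsal2000, §2 p. 28 (φψ = ω)] -/
theorem dvd_iff_dvd_of_isPrimitive {Φ₀ : AddSubgroup (geomTorsion W (p : ℤ))}
    (hΦ : IsRationalLine W p Φ₀)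
    {m : ℕ} [NeZero m] (φ : DirichletCharacter (ZMod p) m)
    {d : ℕ} [NeZero d] (ψ : DirichletCharacter (ZMod p) d)
    (hφ0 : ∀ (σ : absoluteGaloisGroup ℚ), ∀ P ∈ Φ₀,
      σ • P = (φ ((modNCyclotomicCharacter ℚ m σ : (ZMod m)ˣ) : ZMod m)).val • P)
    (hψ0 : ∀ (σ : absoluteGaloisGroup ℚ) (Q : geomTorsion W (p : ℤ)),
      σ • Q - (ψ ((modNCyclotomicCharacter ℚ d σ : (ZMod d)ˣ) : ZMod d)).val • Q ∈ Φ₀)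
    (hφ : φ.IsPrimitive) (hψ : ψ.IsPrimitive) {ℓ : ℕ} (hℓ : ℓ.Prime) (hℓp : ℓ ≠ p) :
    ℓ ∣ m ↔ ℓ ∣ d := by
  have hpp := hp.out
  have hrel := apply_mul_apply_eq_modNCyclotomicCharacter hΦ φ ψ hφ0 hψ0
  have hmd : m ∣ p * d := level_dvd_mul_of_isPrimitive φ ψ hφ hrel
  have hdm : d ∣ p * m :=
    level_dvd_mul_of_isPrimitive ψ φ hψ (fun σ ↦ by rw [mul_comm]; exact hrel σ)
  have key : ∀ {a b : ℕ}, a ∣ p * b → ℓ ∣ a → ℓ ∣ b := fun hab hℓa ↦ by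
    rcases (Nat.Prime.dvd_mul hℓ).mp (hℓa.trans hab) with h | h
    · exact absurd ((Nat.prime_dvd_prime_iff_eq hℓ hpp).mp h) hℓp
    · exact h
  exact ⟨key hmd, key hdm⟩

/-! ## §4. The Weil relation in the door's form (`hφψ` of p645771 / `…KLFlatPartnerUnitsPsi`) -/

/-- **`hφψ` DISCHARGED.** For a rational line `Φ₀ ≤ E[p]` with PRIMITIVE presentations `φ` mod
`m` (on the line) and `ψ` mod `d` (on the quotient): for every natural `a` prime to `p`,
`φ(a)·a⁻¹ = ψ⁻¹(a)` in `𝔽_p` — at `a` prime to `m d` this is the Weil relation `φ(a)ψ(a) = a`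
(§2), and at `a` sharing a prime `ℓ ≠ p` with `m d` both sides vanish since `ℓ` divides `m` AND `d`
(§3). VERBATIM the binder `hφψ` of `…TwistbackKLFlatPartnerUnits` §1–§3 / `…KLFlatPartnerUnitsPsi`.
[cite: GreenbergVatsal2000, §2 p. 28 (φψ = ω) and §3 pp. 41–42] [cite: SilvermanCSS1997, Ch. II §7–§8 (det ρ̄ = χ)] -/
theorem apply_natCast_mul_inv_eq_inv_apply {Φ₀ : AddSubgroup (geomTorsion W (p : ℤ))}
    (hΦ : IsRationalLine W p Φ₀)
    {m : ℕ} [NeZero m] (φ : DirichletCharacter (ZMod p) m)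
    {d : ℕ} [NeZero d] (ψ : DirichletCharacter (ZMod p) d)
    (hφ0 : ∀ (σ : absoluteGaloisGroup ℚ), ∀ P ∈ Φ₀,
      σ • P = (φ ((modNCyclotomicCharacter ℚ m σ : (ZMod m)ˣ) : ZMod m)).val • P)
    (hψ0 : ∀ (σ : absoluteGaloisGroup ℚ) (Q : geomTorsion W (p : ℤ)),
      σ • Q - (ψ ((modNCyclotomicCharacter ℚ d σ : (ZMod d)ˣ) : ZMod d)).val • Q ∈ Φ₀)
    (hφ : φ.IsPrimitive) (hψ : ψ.IsPrimitive) :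
    ∀ a : ℕ, ¬ p ∣ a → φ (a : ZMod m) * (a : ZMod p)⁻¹ = ψ⁻¹ (a : ZMod d) := by
  intro a hpa
  have hpp := hp.out
  by_cases hcop : a.Coprime (m * d)
  · -- `a` prime to `p m d`: the Weil relation
    have ha : a.Coprime (p * m * d) := by
      rw [mul_assoc]
      exact Nat.Coprime.mul_right ((Nat.Prime.coprime_iff_not_dvd hpp).mpr hpa).symm hcop
    have h := apply_natCast_mul_apply_natCast hΦ φ ψ hφ0 hψ0 ha
    have ha0 : (a : ZMod p) ≠ 0 := by
      rw [Ne, ZMod.natCast_eq_zero_iff]; exact hpa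
    rw [MulChar.inv_apply_eq_inv']
    symm
    apply inv_eq_of_mul_eq_one_right
    calc ψ (a : ZMod d) * (φ (a : ZMod m) * (a : ZMod p)⁻¹)
        = (φ (a : ZMod m) * ψ (a : ZMod d)) * (a : ZMod p)⁻¹ := by ring
      _ = 1 := by rw [h, mul_inv_cancel₀ ha0]
  · -- a common prime `ℓ ≠ p` of `a` and `m d` divides `m` and `d`: both sides vanish
    obtain ⟨ℓ, hℓ, hℓa, hℓmd⟩ := Nat.Prime.not_coprime_iff_dvd.mp hcop
    have hℓp : ℓ ≠ p := fun h ↦ hpa (h ▸ hℓa)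
    have hℓm : ℓ ∣ m := by
      rcases (Nat.Prime.dvd_mul hℓ).mp hℓmd with h | h
      · exact h
      · exact (dvd_iff_dvd_of_isPrimitive hΦ φ ψ hφ0 hψ0 hφ hψ hℓ hℓp).mpr h
    have hℓd : ℓ ∣ d := (dvd_iff_dvd_of_isPrimitive hΦ φ ψ hφ0 hψ0 hφ hψ hℓ hℓp).mp hℓm
    have hm0 : φ (a : ZMod m) = 0 := by
      apply MulChar.map_nonunit
      rw [ZMod.isUnit_iff_coprime]
      exact fun h ↦ hℓ.one_lt.ne' (Nat.dvd_one.mp (h ▸ Nat.dvd_gcd hℓa hℓm))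
    have hd0 : ψ⁻¹ (a : ZMod d) = 0 := by
      apply MulChar.map_nonunit
      rw [ZMod.isUnit_iff_coprime]
      exact fun h ↦ hℓ.one_lt.ne' (Nat.dvd_one.mp (h ▸ Nat.dvd_gcd hℓa hℓd))
    rw [hm0, hd0, zero_mul]

end Summit.BirchSwinnertonDyer.BirchSwinnertonDyer.Theorems.EisensteinPrimesLineCharactersWeilRelation

end
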